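import Summits.CriticalPhenomena.CardyFormulaZ2.Theses.CardySelfRefinement
import Summits.CriticalPhenomena.CardyFormulaZ2.Theorems.LagHandOff.Negative.ArcSwap
import Literature.Probability.Percolation.QuadCrossingSpaceZ2
import Literature.Probability.Percolation.QuadCrossingSubseqLimits
import Literature.Probability.LatticeModels.DobrushinDiscretisation
import Literature.Probability.Percolation.InterfaceCurves
import HarnessLib

/-!
# The hand-off family of co-oriented same-carrier domains: sub-goal `stub_carrierDetermines_coOriented`
# of stub `stub_carrierDetermines` of line `crosscut-dictionary` for crux `LagHandOff`
# (stmt-CriticalPhenomena-10268)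

Partial helper (the co-oriented half, and the reduction of the reversed half to an in-law
arc-swap statement) for the registered stub `stub_carrierDetermines` (namespace
`Summit.CriticalPhenomena.CardyFormulaZ2.Cruxes.LagHandOff.CrosscutDictionary`): for a Borel
reading `Ψ D : ℋ_ℂ → CurveClass ℂ` to which the bond-`ℤ²` interfaces of every Dobrushin domain
`D` and every admissible discretisation family `E` hand off jointly along every quad-convergent
positive null mesh sequence (`h3`), discretisability of every Dobrushin domain (`h4`) and
`μ ∈ subseqQuadLimits univ`, the law `(Ψ D)_* μ` is the same for two Dobrushin domains `D`, `D'`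
with the same carrier, the same marked points AND THE SAME ARCS (`stub_carrierDetermines_coOriented`).

Proof (E-blindness + uniqueness of weak limits).  `ZdDiscretisationFamily D E` reads `D` only
through `(carrier, arc 0, arc 1, pt 0, pt 1)` (`zdDiscretisationFamily_of_arc_eq`), and
`bondInterfaceIn D (E δ)` only through `(pt 0, pt 1)` (the endpoint rule `orientCurve`; the
disprover's landed `Negative.bondInterfaceIn_eq_of_pt_eq`, `Theorems/LagHandOff/Negative/ArcSwap.lean`),
so an admissible family `E` of `D` (from `h4`) is one of `D'`
with the same interfaces; testing `h3` at `(D, E)` and `(D', E)` on `g ∘ snd` exhibits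
`∫ g d(Ψ D)_* μ` and `∫ g d(Ψ D')_* μ` as limits of ONE real sequence for every bounded continuous
`g` (`integral_map`, `tendsto_nhds_unique`), and finite Borel measures on the metric space
`CurveClass ℂ` are determined by such integrals (`ext_of_forall_integral_eq_of_IsFiniteMeasure`).
The same argument with two families `E` of `D` and `E'` of an arc-SWAPPED `D'` reduces the
reversed half of `stub_carrierDetermines` to the `Ψ`-free lattice statement "the `(ab)`-wired
and the `(ba)`-wired interfaces of one carrier are asymptotically equal in law along every
quad-convergent mesh sequence" (`map_eq_of_arc_swap_of_arcSwapInLaw`) — self-duality of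
bond-`ℤ²` at `p = ½` read on the medial lattice, which lands on the half-mesh-shifted lattice
and is NOT proved here.  (For the dictionary's OWN reading the whole registered stub also
follows in three lines from the slit-extension field `hext` of the enlarged
`stub_crosscutDictionary`: disprover's `Negative.carrierDetermines_of_slitExtension`,
`Theorems/LagHandOff/Negative/ArcSwapStubs.lean`.)  References: M. Aizenman, A. Burchard, Duke Math. J. 99 (1999) §2.1
(curve space); S. Smirnov, C. R. Acad. Sci. 333 (2001) §2; folklore (weak limits are unique).
-/

noncomputable section

open MeasureTheory Filter Set Topology
open scoped BoundedContinuousFunction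
open Literature.Probability.Percolation Literature.Probability.LatticeModels
open Literature.Probability.RandomPlanarGeometry Literature.Probability.Percolation.QuadCrossing
open Summit.CriticalPhenomena.CardyFormulaZ2.Theses.CardySelfRefinement

namespace Summit.CriticalPhenomena.CardyFormulaZ2.Cruxes.LagHandOff.CrosscutDictionary

/-! ### E-blindness: what a discretisation family and its interfaces read off the domain -/

/-- **A discretisation family reads the domain only through `(carrier, arcs, marked points)`**:
an admissible `ℤ²`-discretisation family of `D` is one of every `D'` with the same carrier, the
same marked points and the same two arcs. -/
theorem zdDiscretisationFamily_of_arc_eq {D D' : DobrushinDomain} {E : ℝ → DiscreteDobrushin}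
    (hE : ZdDiscretisationFamily D E) (hc : D'.carrier = D.carrier) (h0 : D'.pt 0 = D.pt 0)
    (h1 : D'.pt 1 = D.pt 1) (ha0 : D'.arc 0 = D.arc 0) (ha1 : D'.arc 1 = D.arc 1) :
    ZdDiscretisationFamily D' E where
  Ω_eq δ := (hE.Ω_eq δ).trans hc.symm
  δ_eq := hE.δ_eq
  tendsto_arcA := by rw [ha0]; exact hE.tendsto_arcA
  tendsto_arcB := by rw [ha1]; exact hE.tendsto_arcB
  tendsto_zdABEdges := by rw [h0, h1]; exact hE.tendsto_zdABEdges
  eventually_isZdAdmissible := hE.eventually_isZdAdmissible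

/-! ### Uniqueness of weak limits of interface laws -/

/-- **Two readings fed by asymptotically equal interface laws have the same law.** If the
interfaces of `(D, E)` hand off to `Ψ D` and those of `(D', E')` to `Ψ D'` along `δs` under `μ`
(curve marginal of the joint hand-off), and the two interface laws are asymptotically equal when
tested against every bounded continuous `g`, then `(Ψ D')_* μ = (Ψ D)_* μ`. -/
theorem map_eq_of_handsOff_of_tendsto_sub {Ψ : DobrushinDomain → QuadConfig (Set.univ : Set ℂ) → CurveClass ℂ}
    {μ : FiniteMeasure (QuadConfig (Set.univ : Set ℂ))} {δs : ℕ → ℝ} {D D' : DobrushinDomain}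
    {E E' : ℝ → DiscreteDobrushin} (hΨD : Measurable (Ψ D)) (hΨD' : Measurable (Ψ D'))
    (hD : ∀ f : (QuadConfig (Set.univ : Set ℂ) × CurveClass ℂ) →ᵇ ℝ,
      Tendsto (fun n => ∫ ω, f (z2QuadConfig (Set.univ : Set ℂ) (δs n) ω,
          bondInterfaceIn D (E (δs n)) ω) ∂(bondPercolation (zdGraph 2) half))
        atTop (𝓝 (∫ S, f (S, Ψ D S) ∂(μ : Measure (QuadConfig (Set.univ : Set ℂ))))))
    (hD' : ∀ f : (QuadConfig (Set.univ : Set ℂ) × CurveClass ℂ) →ᵇ ℝ,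
      Tendsto (fun n => ∫ ω, f (z2QuadConfig (Set.univ : Set ℂ) (δs n) ω,
          bondInterfaceIn D' (E' (δs n)) ω) ∂(bondPercolation (zdGraph 2) half))
        atTop (𝓝 (∫ S, f (S, Ψ D' S) ∂(μ : Measure (QuadConfig (Set.univ : Set ℂ))))))
    (hsub : ∀ g : CurveClass ℂ →ᵇ ℝ,
      Tendsto (fun n => ∫ ω, g (bondInterfaceIn D' (E' (δs n)) ω) ∂(bondPercolation (zdGraph 2) half) -
          ∫ ω, g (bondInterfaceIn D (E (δs n)) ω) ∂(bondPercolation (zdGraph 2) half))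
        atTop (𝓝 0)) :
    (μ : Measure (QuadConfig (Set.univ : Set ℂ))).map (Ψ D') =
      (μ : Measure (QuadConfig (Set.univ : Set ℂ))).map (Ψ D) := by
  refine ext_of_forall_integral_eq_of_IsFiniteMeasure fun g => ?_
  rw [integral_map hΨD'.aemeasurable g.continuous.aestronglyMeasurable,
    integral_map hΨD.aemeasurable g.continuous.aestronglyMeasurable]
  have t1 := hD' (g.compContinuous ⟨Prod.snd, continuous_snd⟩)
  have t2 := hD (g.compContinuous ⟨Prod.snd, continuous_snd⟩)
  simp only [BoundedContinuousFunction.compContinuous_apply, ContinuousMap.coe_mk] at t1 t2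
  have t3 := (hsub g).add t2
  rw [zero_add] at t3
  exact tendsto_nhds_unique t1 (t3.congr fun n => sub_add_cancel _ _)

/-! ### The co-oriented half of `stub_carrierDetermines` -/

/-- **Co-oriented same-carrier domains have the same hand-off law** (sub-goal
`stub_carrierDetermines_coOriented` of `stub_carrierDetermines`).  For a Borel reading `Ψ` to
which the lattice interfaces hand off jointly along every quad-convergent positive null mesh
sequence, if every Dobrushin domain is `ℤ²`-discretisable then for every subsequential
quad-crossing limit `μ` and all Dobrushin domains `D`, `D'` with the same carrier, the same
marked points and the same arcs, `(Ψ D')_* μ = (Ψ D)_* μ`: an admissible family of `D` is one of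
`D'` with the same interfaces, and weak limits are unique. -/
theorem stub_carrierDetermines_coOriented : ∀ Ψ : DobrushinDomain → QuadConfig (Set.univ : Set ℂ) → CurveClass ℂ, (∀ D : DobrushinDomain, Measurable (Ψ D)) → (∀ (μ : FiniteMeasure (QuadConfig (Set.univ : Set ℂ))) (δs : ℕ → ℝ), (∀ n, 0 < δs n) → Tendsto δs atTop (𝓝 0) → Tendsto (fun n => z2QuadLaw (Set.univ : Set ℂ) (δs n)) atTop (𝓝 μ) → ∀ (D : DobrushinDomain) (E : ℝ → DiscreteDobrushin), ZdDiscretisationFamily D E → ∀ f : (QuadConfig (Set.univ : Set ℂ) × CurveClass ℂ) →ᵇ ℝ, Tendsto (fun n => ∫ ω, f (z2QuadConfig (Set.univ : Set ℂ) (δs n) ω, bondInterfaceIn D (E (δs n)) ω) ∂(bondPercolation (zdGraph 2) half)) atTop (𝓝 (∫ S, f (S, Ψ D S) ∂(μ : Measure (QuadConfig (Set.univ : Set ℂ)))))) → (∀ D : DobrushinDomain, ∃ E : ℝ → DiscreteDobrushin, ZdDiscretisationFamily D E) → ∀ μ ∈ subseqQuadLimits (Set.univ : Set ℂ), ∀ D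 D' : DobrushinDomain, D'.carrier = D.carrier → D'.pt 0 = D.pt 0 → D'.pt 1 = D.pt 1 → D'.arc 0 = D.arc 0 → D'.arc 1 = D.arc 1 → (μ : Measure (QuadConfig (Set.univ : Set ℂ))).map (Ψ D') = (μ : Measure (QuadConfig (Set.univ : Set ℂ))).map (Ψ D) := by
  intro Ψ h1 h3 h4 μ hμ D D' hc h0 h1' ha0 ha1
  obtain ⟨δs, hpos, hlim, hconv⟩ := (isSubseqQuadLimit_iff Set.univ μ).1 hμ
  obtain ⟨E, hE⟩ := h4 D
  have hE' : ZdDiscretisationFamily D' E := zdDiscretisationFamily_of_arc_eq hE hc h0 h1' ha0 ha1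
  refine map_eq_of_handsOff_of_tendsto_sub (h1 D) (h1 D') (h3 μ δs hpos hlim hconv D E hE)
    (h3 μ δs hpos hlim hconv D' E hE') fun g => ?_
  simp only [Summit.CriticalPhenomena.CardyFormulaZ2.Theorems.LagHandOff.Negative.bondInterfaceIn_eq_of_pt_eq
    h0 h1', sub_self]
  exact tendsto_const_nhds

/-! ### The reversed half, reduced to an in-law arc-swap statement -/

/-- **The reversed half of `stub_carrierDetermines` from an in-law arc swap.**  If, along every
quad-convergent positive null mesh sequence, the interfaces of an admissible family of `D` and
of an admissible family of an arc-SWAPPED same-carrier same-marks `D'` (wired arc `(ba)` instead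
of `(ab)`) are asymptotically equal in law (tested on bounded continuous functions) — the
self-duality content — then `(Ψ D')_* μ = (Ψ D)_* μ` for every such pair and every
`μ ∈ subseqQuadLimits univ`. -/
theorem map_eq_of_arc_swap_of_arcSwapInLaw : ∀ Ψ : DobrushinDomain → QuadConfig (Set.univ : Set ℂ) → CurveClass ℂ, (∀ D : DobrushinDomain, Measurable (Ψ D)) → (∀ (μ : FiniteMeasure (QuadConfig (Set.univ : Set ℂ))) (δs : ℕ → ℝ), (∀ n, 0 < δs n) → Tendsto δs atTop (𝓝 0) → Tendsto (fun n => z2QuadLaw (Set.univ : Set ℂ) (δs n)) atTop (𝓝 μ) → ∀ (D : DobrushinDomain) (E : ℝ → DiscreteDobrushin), ZdDiscretisationFamily D E → ∀ f : (QuadConfig (Set.univ : Set ℂ) × CurveClass ℂ) →ᵇ ℝ, Tendsto (fun n => ∫ ω, f (z2QuadConfig (Set.univ : Set ℂ) (δs n) ω, bondInterfaceIn D (E (δs n)) ω) ∂(bondPercolation (zdGraph 2) half)) atTop (𝓝 (∫ S, f (S, Ψ D S) ∂(μ : Measure (QuadConfig (Set.univ : Set ℂ)))))) → (∀ D : DobrushinDomain,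 ∃ E : ℝ → DiscreteDobrushin, ZdDiscretisationFamily D E) → (∀ (μ : FiniteMeasure (QuadConfig (Set.univ : Set ℂ))) (δs : ℕ → ℝ), (∀ n, 0 < δs n) → Tendsto δs atTop (𝓝 0) → Tendsto (fun n => z2QuadLaw (Set.univ : Set ℂ) (δs n)) atTop (𝓝 μ) → ∀ (D D' : DobrushinDomain) (E E' : ℝ → DiscreteDobrushin), D'.carrier = D.carrier → D'.pt 0 = D.pt 0 → D'.pt 1 = D.pt 1 → D'.arc 0 = D.arc 1 → D'.arc 1 = D.arc 0 → ZdDiscretisationFamily D E → ZdDiscretisationFamily D' E' → ∀ g : CurveClass ℂ →ᵇ ℝ, Tendsto (fun n => ∫ ω, g (bondInterfaceIn D' (E' (δs n)) ω) ∂(bondPercolation (zdGraph 2) half) - ∫ ω, g (bondInterfaceIn D (E (δs n)) ω) ∂(bondPercolation (zdGraph 2) half)) atTop (𝓝 0)) → ∀ μ ∈ subseqQuadLimits (Set.univ : Set ℂ), ∀ D D' : DobrushinDomain, D'.carrier = D.carrier → D'.pt 0 = D.pt 0 → D'.pt 1 = D.pt 1 → D'.arc 0 = D.arc 1 → D'.arc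 1 = D.arc 0 → (μ : Measure (QuadConfig (Set.univ : Set ℂ))).map (Ψ D') = (μ : Measure (QuadConfig (Set.univ : Set ℂ))).map (Ψ D) := by
  intro Ψ h1 h3 h4 hswap μ hμ D D' hc h0 h1' ha0 ha1
  obtain ⟨δs, hpos, hlim, hconv⟩ := (isSubseqQuadLimit_iff Set.univ μ).1 hμ
  obtain ⟨E, hE⟩ := h4 D
  obtain ⟨E', hE'⟩ := h4 D'
  exact map_eq_of_handsOff_of_tendsto_sub (h1 D) (h1 D') (h3 μ δs hpos hlim hconv D E hE)
    (h3 μ δs hpos hlim hconv D' E' hE')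
    (hswap μ δs hpos hlim hconv D D' E E' hc h0 h1' ha0 ha1 hE hE')

end Summit.CriticalPhenomena.CardyFormulaZ2.Cruxes.LagHandOff.CrosscutDictionary

end
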